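import Mathlib.Analysis.Distribution.SchwartzSpace.Fourier
import Mathlib.MeasureTheory.Function.L2Space
import Literature.Analysis.Calculus.SchwartzTaylorTranslate
import HarnessLib

/-!
# Pieces of the separable approximation of the frequency kernel of `[H, f]` (App. D Rem. 48 of CC 2021)

RH-FREE analysis (cell `rh-crit`, sub-cell cc, seat t13; bricks for the last open step — the "direct kernel
estimate" of App. D Rem. 48, p. 33 L39–41 — of the discharge of the tree fact `CC2021_lemma_D47` via
`isInfiniteOrder_quantizedDiff_of_frequencyKernelApprox`).  On the quadrant `{ξ > 0 ≥ η}` the frequency kernel is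
`−2 f̂(ξ − η) = −2 f̂(u + v)` (`u = ξ`, `v = −η ≥ 0`); on a box `u ∈ (jh, (j+1)h]` its Taylor polynomial in `u` at
`jh` is the separable sum `Σ_{l≤d} [−2 (l!)⁻¹ (ξ − jh)^l 1_{box}(ξ)]·[f̂^{(l)}(jh − η)]`.  Here: the box monomials are
in `L²(ℝ)` (`memLp_two_boxMonomial`), so are the `η`-side pieces `conj(f̂^{(l)}(jh−η)) 1_{η≤0}`
(`memLp_two_schwartzDeriv_reflect`), and the pointwise remainder bound on the strip
(`norm_quadrantKernel_sub_boxTaylor_le`, from `SchwartzMap.norm_sub_taylor_translate_le`):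
`‖−2 f̂(ξ−η) − Σ_{l≤d} −2 (l!)⁻¹(ξ−jh)^l f̂^{(l)}(jh−η)‖ ≤ 2C h^{d+1} (1+|η|)^{−N}`.
WHAT THIS IS NOT: any claim about RH; not yet the assembled `L²(ℝ²)` rate bound.  Theorems only (net debt 0).
-/

noncomputable section

open MeasureTheory Complex Set
open scoped Real FourierTransform Nat

namespace Literature.NumberTheory.ConnesConsani2021

open Literature.Analysis.Calculus

/-- RH-FREE. **Box monomials are square-integrable**: `ξ ↦ c (ξ − x₀)^l 1_{(x₀, x₀+h]}(ξ) ∈ L²(ℝ)`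
(bounded with support of finite measure) — the `ξ`-side pieces of the separable approximants.
[cite: ConnesConsani2021, App. D Rem. 48 p. 33 (arXiv chunk p0033:L39–41)] -/
theorem memLp_two_boxMonomial (x₀ h : ℝ) (l : ℕ) (c : ℂ) :
    MemLp (fun ξ : ℝ => c * ((ξ - x₀) ^ l : ℝ) * (Ioc x₀ (x₀ + h)).indicator (fun _ => (1 : ℂ)) ξ)
      2 (volume : Measure ℝ) := by
  have hcont : Continuous fun ξ : ℝ => c * (((ξ - x₀) ^ l : ℝ) : ℂ) := by fun_prop
  have heq : (fun ξ : ℝ => c * ((ξ - x₀) ^ l : ℝ) * (Ioc x₀ (x₀ + h)).indicator (fun _ => (1 : ℂ)) ξ) =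
      (Ioc x₀ (x₀ + h)).indicator fun ξ : ℝ => c * (((ξ - x₀) ^ l : ℝ) : ℂ) := by
    funext ξ
    by_cases hξ : ξ ∈ Ioc x₀ (x₀ + h)
    · rw [Set.indicator_of_mem hξ, Set.indicator_of_mem hξ, mul_one]
    · rw [Set.indicator_of_notMem hξ, Set.indicator_of_notMem hξ, mul_zero]
  rw [heq, memLp_indicator_iff_restrict measurableSet_Ioc]
  have hfin : IsFiniteMeasure ((volume : Measure ℝ).restrict (Ioc x₀ (x₀ + h))) :=
    ⟨by rw [Measure.restrict_apply_univ]; exact measure_Ioc_lt_top⟩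
  -- bounded continuous function on a finite measure space
  obtain ⟨M, hM⟩ : ∃ M : ℝ, ∀ ξ ∈ Icc x₀ (x₀ + h), ‖c * (((ξ - x₀) ^ l : ℝ) : ℂ)‖ ≤ M := by
    obtain ⟨M, hM⟩ := isCompact_Icc.exists_bound_of_continuousOn (hcont.continuousOn (s := Icc x₀ (x₀ + h)))
    exact ⟨M, hM⟩
  refine MemLp.of_bound hcont.aestronglyMeasurable M ?_
  rw [ae_restrict_iff' measurableSet_Ioc]
  exact Filter.Eventually.of_forall fun ξ hξ => hM ξ (Ioc_subset_Icc_self hξ)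

/-- RH-FREE. **Pointwise remainder of the box-Taylor approximant on the strip** `(jh, (j+1)h] × (−∞, 0]`:
`‖−2 f̂(ξ−η) − Σ_{l≤d} −2 (l!)⁻¹ (ξ−jh)^l f̂^{(l)}(jh−η)‖ ≤ 2 C h^{d+1} (1+|η|)^{−N}` with the constant of
`SchwartzMap.norm_sub_taylor_translate_le` (`x₀ = jh`, `u = ξ`, `v = −η`); stated for any Schwartz `g` in place
of `f̂`.  [cite: ConnesConsani2021, App. D Rem. 48 p. 33 (arXiv chunk p0033:L39–41); Lemma 47 proof L24–36] -/
theorem norm_quadrantKernel_sub_boxTaylor_le (g : SchwartzMap ℝ ℂ) (d N : ℕ) :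
    ∃ C : ℝ, 0 ≤ C ∧ ∀ (j : ℕ) (h ξ η : ℝ), 0 < h → ξ ∈ Ioc ((j : ℝ) * h) ((j : ℝ) * h + h) → η ≤ 0 →
      ‖(-2) * (g : ℝ → ℂ) (ξ - η) - ∑ l ∈ Finset.range (d + 1),
          (-2) * ((((l ! : ℝ)⁻¹ * (ξ - j * h) ^ l : ℝ) : ℂ) * iteratedDeriv l g (j * h - η))‖
        ≤ 2 * C * h ^ (d + 1) * ((1 + |η|) ^ N)⁻¹ := by
  obtain ⟨C, hC0, hC⟩ := SchwartzMap.norm_sub_taylor_translate_le g d N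
  refine ⟨C, hC0, fun j h ξ η hh hξ hη => ?_⟩
  have hx₀ : (0 : ℝ) ≤ (j : ℝ) * h := by positivity
  have key := hC ((j : ℝ) * h) h ξ (-η) hx₀ hh ⟨hξ.1.le, hξ.2⟩ (by linarith)
  have h1 : ξ + -η = ξ - η := by ring
  have h2 : (j : ℝ) * h + -η = j * h - η := by ring
  have h3 : (1 : ℝ) + -η = 1 + |η| := by rw [abs_of_nonpos hη]
  rw [h1, h2, h3] at key
  have hsum : ∑ l ∈ Finset.range (d + 1),
      (-2) * ((((l ! : ℝ)⁻¹ * (ξ - j * h) ^ l : ℝ) : ℂ) * iteratedDeriv l g (j * h - η)) =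
      (-2) * ∑ l ∈ Finset.range (d + 1),
        (((l ! : ℝ)⁻¹ * (ξ - j * h) ^ l : ℝ)) • iteratedDeriv l g (j * h - η) := by
    rw [Finset.mul_sum]
    refine Finset.sum_congr rfl fun l _ => ?_
    rw [Complex.real_smul]
  rw [hsum, ← mul_sub, norm_mul, show ‖(-2 : ℂ)‖ = 2 by simp]
  calc 2 * ‖(g : ℝ → ℂ) (ξ - η) - ∑ l ∈ Finset.range (d + 1),
        (((l ! : ℝ)⁻¹ * (ξ - j * h) ^ l : ℝ)) • iteratedDeriv l g (j * h - η)‖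
      ≤ 2 * (C * h ^ (d + 1) * ((1 + |η|) ^ N)⁻¹) := by gcongr
    _ = 2 * C * h ^ (d + 1) * ((1 + |η|) ^ N)⁻¹ := by ring

/-- RH-FREE. Iterating Mathlib's `SchwartzMap.derivCLM` gives the iterated derivative as a Schwartz function.
[folklore] -/
private theorem coe_derivCLM_iterate (g : SchwartzMap ℝ ℂ) (l : ℕ) :
    (((SchwartzMap.derivCLM ℝ ℂ)^[l] g : SchwartzMap ℝ ℂ) : ℝ → ℂ) = iteratedDeriv l g := by
  induction l with
  | zero => simp
  | succ l ih =>
    rw [Function.iterate_succ_apply', iteratedDeriv_succ, ← ih]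
    funext x
    exact SchwartzMap.derivCLM_apply ℝ _ x

/-- RH-FREE. **Reflected translates of the derivatives of a Schwartz function, cut to a half-line, are
square-integrable**: `η ↦ conj(g^{(l)}(x₀ − η)) 1_{η ≤ 0} ∈ L²(ℝ)` — the `η`-side pieces `c_{j,l}` of the separable
approximants (so that `a(ξ) conj(c(η))` is the Taylor term `… g^{(l)}(jh − η)`).
[cite: ConnesConsani2021, App. D Rem. 48 p. 33 (arXiv chunk p0033:L39–41)] -/
theorem memLp_two_schwartzDeriv_reflect (g : SchwartzMap ℝ ℂ) (x₀ : ℝ) (l : ℕ) :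
    MemLp (fun η : ℝ => (starRingEnd ℂ) (iteratedDeriv l g (x₀ - η)) *
      (Iic 0).indicator (fun _ => (1 : ℂ)) η) 2 (volume : Measure ℝ) := by
  set G : SchwartzMap ℝ ℂ := (SchwartzMap.derivCLM ℝ ℂ)^[l] g with hG
  have hGcoe : (G : ℝ → ℂ) = iteratedDeriv l g := coe_derivCLM_iterate g l
  -- `η ↦ g^{(l)}(x₀ − η)` is in `L²`
  have h1 : MemLp (fun η : ℝ => iteratedDeriv l g (x₀ - η)) 2 (volume : Measure ℝ) := by
    have h := (G.memLp 2 (volume : Measure ℝ)).comp_measurePreserving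
      (Measure.measurePreserving_sub_left (volume : Measure ℝ) x₀)
    rw [hGcoe] at h
    exact h
  -- conjugation preserves the norm
  have h2 : MemLp (fun η : ℝ => (starRingEnd ℂ) (iteratedDeriv l g (x₀ - η))) 2 (volume : Measure ℝ) := by
    refine h1.of_le ?_ (Filter.Eventually.of_forall fun η => by rw [Complex.norm_conj])
    have hc : Continuous fun η : ℝ => iteratedDeriv l g (x₀ - η) := by
      rw [← hGcoe]; exact G.continuous.comp (continuous_const.sub continuous_id)
    exact (Complex.continuous_conj.comp hc).aestronglyMeasurable
  -- cut to the half-line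
  have heq : (fun η : ℝ => (starRingEnd ℂ) (iteratedDeriv l g (x₀ - η)) *
      (Iic 0).indicator (fun _ => (1 : ℂ)) η) =
      (Iic (0 : ℝ)).indicator fun η : ℝ => (starRingEnd ℂ) (iteratedDeriv l g (x₀ - η)) := by
    funext η
    by_cases hη : η ∈ Iic (0 : ℝ)
    · rw [Set.indicator_of_mem hη, Set.indicator_of_mem hη, mul_one]
    · rw [Set.indicator_of_notMem hη, Set.indicator_of_notMem hη, mul_zero]
  rw [heq]
  exact h2.indicator measurableSet_Iic

end Literature.NumberTheory.ConnesConsani2021
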